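import Summits.Ventures.Crystal3D.Theorems.StickyWulffConstantNoReconstructionGainCosetFilm
import Summits.Ventures.Crystal3D.Theorems.StickyWulffConstantNoReconstructionGainSymmetry
import HarnessLib

/-!
# The atom for ALL basal-family Barlow films at normals within `54.7°` of the stacking axis

HONEST FRAMING. Part of the venture `Summits/Ventures/Crystal3D` (cell `crystal3d-full`), helper
`--supports` the crux `NoReconstructionGain` (stmt-Ventures-19144, route
`route-Ventures-StickyWulffConstant`), line `adhesion`.  Let `Λ₀ = fccStacking 1 √(2/3)`,
`w = barlowOffset 1`, and `B = Λ₀ ∪ (Λ₀ + w) ∪ (Λ₀ − w)` — the set of ALL Barlow positions (letters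
`A/B/C` at every basal layer): every fcc, hcp, dhcp, twinned, faulted, islanded … structure whose
close-packed planes are the basal planes of `Λ₀` is a subset of `B`.  The structural fact:

* `basal_unit_height` — a unit vector joining two points of `B` has third coordinate `0` or `±√(2/3)`,
  and the in-plane ones (`0`) are lattice bond vectors `±u, ±v, ±(u − v)` (three lines).  (Coset
  contact lemma `fcc_coset_unit_height` of `…CosetFilm` + `fcc_unit_directions`.)

Consequently, under the LINEAR potential `⟪·, ν⟫` every ball of a `B`-film costs at most
`6` (three in-plane antipodal lines) `+ 2·3` (the polar partners on the `ν`-negative side: at most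
three, cone lemma) `= 12`, PROVIDED all polar directions on one side of the basal plane are
`ν`-positive and on the other `ν`-negative — which is exactly `ν₃² > 1/3`, i.e. `ν` within `54.7°` of
`±e₃` (every unit `ν` is within `54.7°` of SOME `(111)` axis; `(100)` is the boundary case):

* `basal_noGainPotential` — the per-ball lemma;
* `basalBarlowFilm_adhesion` (**the rung**, `R = 1`, `C = 0`; registered by name): for every unit `ν`
  with `ν₃² > 1/3`, every `ρ ≥ 1`, every finite unit packing `X ⊇ P` around the `ν`-slab sample whose
  film lies in `B` and above the cut (`⟪q, ν⟫ > −R` for film balls): `#cross(P, X \ P) ≤ D(X \ P)`.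
  Twin lamellae, hcp/dhcp grains, intrinsic/extrinsic faults REACHING THE INTERFACE, islands in
  both hollow types — all at once, no rim set, every coordination.

Census (RUNGS-g8 §4): all 120 twin-lamella films had a linear certificate; this is the theorem for
`θ(ν, e₃) < 54.7°` with the canonical choice `ν' = ν`.  Other `{111}` families: transport by lattice
symmetries (not done here).

WHAT THIS IS NOT: normals with `ν₃² ≤ 1/3` for basal-family films (there `ν' ≠ ν` is needed and is
only censused); films mixing Barlow families; rung F-C1 not moved.
-/

noncomputable section

namespace Summit.Ventures.Crystal3D.Theorems

open Summit.Ventures.Crystal3D Finset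
open Literature.MathematicalPhysics.StatisticalMechanics (barlowPos barlowStacking fccStacking
  barlowOffset triangularVec₁ triangularVec₂ layerNormal constHagg haggLabel_const barlowPos_apply_two
  three_smul_barlowOffset orderedContacts contactDeficiency)
open scoped InnerProductSpace

/-! ### Lattice bookkeeping -/

/-- `3w = u + v` is a lattice vector. -/
theorem three_barlowOffset_mem :
    (3 : ℝ) • barlowOffset 1 ∈ fccStacking 1 (Real.sqrt (2 / 3)) := by
  refine ⟨0, 1, 1, ?_⟩
  rw [three_smul_barlowOffset]
  simp [barlowPos]

/-- A unit vector `v` with `v + w ∈ Λ₀` points one layer DOWN. -/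
theorem fcc_negCoset_unit_height (v : EuclideanSpace ℝ (Fin 3))
    (hv : v + barlowOffset 1 ∈ fccStacking 1 (Real.sqrt (2 / 3))) (h1 : ‖v‖ = 1) :
    v 2 = -Real.sqrt (2 / 3) := by
  have h := fcc_coset_unit_height (-v) (by
    have : -v - barlowOffset 1 = -(v + barlowOffset 1) := by abel
    rw [this]; exact fcc_neg_mem hv) (by rw [norm_neg, h1])
  rw [PiLp.neg_apply] at h
  linarith

/-- **Unit vectors of `B − B`.**  If `q` and `x` are Barlow positions of the basal family
(`∈ Λ₀ ∪ (Λ₀ + w) ∪ (Λ₀ − w)`) at distance `1`, then `(x − q)₂ ∈ {0, √(2/3), −√(2/3)}`, and in the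
in-plane case `x − q` is one of the six lattice bond vectors `± pos c`, `c ∈ {(0,1,0),(0,0,1),(0,1,−1)}`. -/
theorem basal_unit_height {q x : EuclideanSpace ℝ (Fin 3)}
    (hq : q ∈ fccStacking 1 (Real.sqrt (2 / 3)) ∨ q - barlowOffset 1 ∈ fccStacking 1 (Real.sqrt (2 / 3)) ∨
      q + barlowOffset 1 ∈ fccStacking 1 (Real.sqrt (2 / 3)))
    (hx : x ∈ fccStacking 1 (Real.sqrt (2 / 3)) ∨ x - barlowOffset 1 ∈ fccStacking 1 (Real.sqrt (2 / 3)) ∨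
      x + barlowOffset 1 ∈ fccStacking 1 (Real.sqrt (2 / 3)))
    (hd : dist q x = 1) :
    ((x - q) 2 = 0 ∧ ∃ c ∈ ([((0 : ℤ), (1 : ℤ), (0 : ℤ)), (0, 0, 1), (0, 1, -1)] : List (ℤ × ℤ × ℤ)),
        x = q + barlowPos 1 (Real.sqrt (2 / 3)) constHagg c.1 c.2.1 c.2.2 ∨
        x = q - barlowPos 1 (Real.sqrt (2 / 3)) constHagg c.1 c.2.1 c.2.2) ∨
      (x - q) 2 = Real.sqrt (2 / 3) ∨ (x - q) 2 = -Real.sqrt (2 / 3) := by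
  set Λ := fccStacking 1 (Real.sqrt (2 / 3)) with hΛ
  set w : EuclideanSpace ℝ (Fin 3) := barlowOffset 1 with hw
  have hn : ‖x - q‖ = 1 := by rw [← dist_eq_norm, dist_comm]; exact hd
  have hpos : 0 < Real.sqrt (2 / 3) := Real.sqrt_pos.2 (by norm_num)
  have h3w : (3 : ℝ) • w ∈ Λ := three_barlowOffset_mem
  -- the three outcomes from the three lemmas
  have caseΛ : x - q ∈ Λ → ((x - q) 2 = 0 ∧ ∃ c ∈ ([((0 : ℤ), (1 : ℤ), (0 : ℤ)), (0, 0, 1), (0, 1, -1)] :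
        List (ℤ × ℤ × ℤ)), x = q + barlowPos 1 (Real.sqrt (2 / 3)) constHagg c.1 c.2.1 c.2.2 ∨
        x = q - barlowPos 1 (Real.sqrt (2 / 3)) constHagg c.1 c.2.1 c.2.2) ∨
      (x - q) 2 = Real.sqrt (2 / 3) ∨ (x - q) 2 = -Real.sqrt (2 / 3) := by
    intro hv
    -- write `x - q` as a unit lattice vector from the origin
    have h0 : (0 : EuclideanSpace ℝ (Fin 3)) ∈ Λ := ⟨0, 0, 0, barlowPos_zero_zero_zero.symm⟩
    obtain ⟨c, hc, hcx⟩ := fcc_unit_directions 0 (x - q) h0 hv (by rw [dist_eq_norm, zero_sub, norm_neg, hn])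
    rw [zero_add, zero_sub] at hcx
    have h2 : (x - q) 2 = (c.1 : ℝ) * Real.sqrt (2 / 3) ∨ (x - q) 2 = -((c.1 : ℝ) * Real.sqrt (2 / 3)) := by
      rcases hcx with h | h
      · left; rw [h, barlowPos_apply_two]
      · right; rw [h, PiLp.neg_apply, barlowPos_apply_two]
    have hxq : x = q + (x - q) := by abel
    simp only [List.mem_cons, List.mem_nil_iff, or_false] at hc
    rcases hc with rfl | rfl | rfl | rfl | rfl | rfl
    · left; refine ⟨by rcases h2 with h | h <;> rw [h] <;> simp, (0, 1, 0), by simp, ?_⟩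
      rcases hcx with h | h
      · left; rw [← h]; abel
      · right; rw [hxq, h]; abel
    · left; refine ⟨by rcases h2 with h | h <;> rw [h] <;> simp, (0, 0, 1), by simp, ?_⟩
      rcases hcx with h | h
      · left; rw [← h]; abel
      · right; rw [hxq, h]; abel
    · right; rcases h2 with h | h <;> [left; right] <;> rw [h] <;> simp
    · left; refine ⟨by rcases h2 with h | h <;> rw [h] <;> simp, (0, 1, -1), by simp, ?_⟩
      rcases hcx with h | h
      · left; rw [← h]; abel
      · right; rw [hxq, h]; abel
    · right; rcases h2 with h | h <;> [right; left] <;> rw [h] <;> simp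
    · right; rcases h2 with h | h <;> [right; left] <;> rw [h] <;> simp
  have caseUp : x - q - w ∈ Λ → ((x - q) 2 = 0 ∧ ∃ c ∈ ([((0 : ℤ), (1 : ℤ), (0 : ℤ)), (0, 0, 1), (0, 1, -1)] :
        List (ℤ × ℤ × ℤ)), x = q + barlowPos 1 (Real.sqrt (2 / 3)) constHagg c.1 c.2.1 c.2.2 ∨
        x = q - barlowPos 1 (Real.sqrt (2 / 3)) constHagg c.1 c.2.1 c.2.2) ∨
      (x - q) 2 = Real.sqrt (2 / 3) ∨ (x - q) 2 = -Real.sqrt (2 / 3) :=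
    fun hv => Or.inr (Or.inl (fcc_coset_unit_height (x - q) hv hn))
  have caseDown : x - q + w ∈ Λ → ((x - q) 2 = 0 ∧ ∃ c ∈ ([((0 : ℤ), (1 : ℤ), (0 : ℤ)), (0, 0, 1), (0, 1, -1)] :
        List (ℤ × ℤ × ℤ)), x = q + barlowPos 1 (Real.sqrt (2 / 3)) constHagg c.1 c.2.1 c.2.2 ∨
        x = q - barlowPos 1 (Real.sqrt (2 / 3)) constHagg c.1 c.2.1 c.2.2) ∨
      (x - q) 2 = Real.sqrt (2 / 3) ∨ (x - q) 2 = -Real.sqrt (2 / 3) :=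
    fun hv => Or.inr (Or.inr (fcc_negCoset_unit_height (x - q) hv hn))
  -- nine combinations of cosets
  rcases hq with hq | hq | hq <;> rcases hx with hx | hx | hx
  · exact caseΛ (fcc_sub_site_mem hx hq)
  · exact caseUp (by have := fcc_sub_site_mem hx hq; rwa [show x - w - q = x - q - w by abel] at this)
  · exact caseDown (by have := fcc_sub_site_mem hx hq; rwa [show x + w - q = x - q + w by abel] at this)
  · exact caseDown (by have := fcc_sub_site_mem hx hq; rwa [show x - (q - w) = x - q + w by abel] at this)
  · exact caseΛ (by have := fcc_sub_site_mem hx hq; rwa [show x - w - (q - w) = x - q by abel] at this)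
  · -- `x ∈ Λ − w`, `q ∈ Λ + w`: `x − q + 2w ∈ Λ`, hence `x − q − w ∈ Λ`
    refine caseUp ?_
    have h1 := fcc_sub_site_mem hx hq
    have h2 := fcc_sub_site_mem h1 h3w
    rwa [show x + w - (q - w) - (3 : ℝ) • w = x - q - w by module] at h2
  · exact caseUp (by have := fcc_sub_site_mem hx hq; rwa [show x - (q + w) = x - q - w by abel] at this)
  · -- `x ∈ Λ + w`, `q ∈ Λ − w`: `x − q − 2w ∈ Λ`, hence `x − q + w ∈ Λ`
    refine caseDown ?_
    have h1 := fcc_sub_site_mem hx hq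
    have h2 := fcc_add_site_mem h1 h3w
    rwa [show x - w - (q + w) + (3 : ℝ) • w = x - q + w by module] at h2
  · exact caseΛ (by have := fcc_sub_site_mem hx hq; rwa [show x + w - (q + w) = x - q by abel] at this)

/-! ### The per-ball lemma -/

/-- For `ν₃² > 1/3` a basal polar direction (`d₂ = ±√(2/3)`, `‖d‖ = 1`) has `⟪d, ν⟫` of the SAME
sign as `d₂ ν₂`: `|ν₂ d₂| = |ν₂|√(2/3) > √(1 − ν₂²)·√(1/3) ≥ |⟪d_∥, ν_∥⟫|`. -/
theorem basal_polar_sign (ν d : EuclideanSpace ℝ (Fin 3)) (hν : ‖ν‖ = 1) (hd : ‖d‖ = 1)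
    (hν3 : 1 / 3 < ν 2 ^ 2) (hd2 : d 2 ^ 2 = 2 / 3) : 0 < ⟪d, ν⟫_ℝ * (d 2 * ν 2) := by
  have hνn : ν 0 ^ 2 + ν 1 ^ 2 + ν 2 ^ 2 = 1 := by
    have := EuclideanSpace.real_norm_sq_eq ν; rw [hν, Fin.sum_univ_three] at this; linarith
  have hdn : d 0 ^ 2 + d 1 ^ 2 + d 2 ^ 2 = 1 := by
    have := EuclideanSpace.real_norm_sq_eq d; rw [hd, Fin.sum_univ_three] at this; linarith
  have hinner : ⟪d, ν⟫_ℝ = d 0 * ν 0 + d 1 * ν 1 + d 2 * ν 2 := by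
    rw [EuclideanSpace.inner_eq_star_dotProduct]
    simp [dotProduct, Fin.sum_univ_three]; ring
  rw [hinner]
  -- Cauchy–Schwarz in the plane: (d₀ν₀ + d₁ν₁)² ≤ (d₀²+d₁²)(ν₀²+ν₁²) = (1/3)(1 − ν₂²) < (2/3)ν₂² = (d₂ν₂)²
  have hcs : (d 0 * ν 0 + d 1 * ν 1) ^ 2 ≤ (d 0 ^ 2 + d 1 ^ 2) * (ν 0 ^ 2 + ν 1 ^ 2) := by
    nlinarith [sq_nonneg (d 0 * ν 1 - d 1 * ν 0)]
  have hlt : (d 0 * ν 0 + d 1 * ν 1) ^ 2 < (d 2 * ν 2) ^ 2 := by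
    have e1 : d 0 ^ 2 + d 1 ^ 2 = 1 / 3 := by linarith
    have e2 : ν 0 ^ 2 + ν 1 ^ 2 = 1 - ν 2 ^ 2 := by linarith
    rw [e1, e2] at hcs
    rw [mul_pow, hd2]
    nlinarith
  nlinarith [sq_nonneg (d 0 * ν 0 + d 1 * ν 1 + d 2 * ν 2), sq_nonneg (d 0 * ν 0 + d 1 * ν 1 - d 2 * ν 2),
    sq_abs (d 2 * ν 2)]

/-- **(T2) at a ball of a basal Barlow film under the `ν`-height potential** (`ν₃² > 1/3`).
`X` a unit packing, `P ⊆ X`, `q` a film ball all of whose partners `x` are basal Barlow positions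
relative to `q` (conclusion of `basal_unit_height`), `Φ` ordered like `⟪·,ν⟫` on the film partners of
`q`, substrate partners strictly `ν`-below `q`.  Then `#below + #plug ≤ (12 − deg q) + #above`. -/
theorem basal_noGainPotential (X P : Finset (EuclideanSpace ℝ (Fin 3)))
    (hX : ∀ p ∈ X, ∀ q ∈ X, p ≠ q → 1 ≤ dist p q) (hPX : P ⊆ X)
    (q : EuclideanSpace ℝ (Fin 3)) (Φ : EuclideanSpace ℝ (Fin 3) → ℤ)
    (ν : EuclideanSpace ℝ (Fin 3)) (hν : ‖ν‖ = 1) (hν3 : 1 / 3 < ν 2 ^ 2)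
    (hlt : ∀ x ∈ X \ P, dist q x = 1 → (Φ x < Φ q ↔ ⟪x, ν⟫_ℝ < ⟪q, ν⟫_ℝ))
    (heq : ∀ x ∈ X \ P, dist q x = 1 → (Φ x = Φ q ↔ ⟪x, ν⟫_ℝ = ⟪q, ν⟫_ℝ))
    (hplug : ∀ p ∈ P, dist q p = 1 → ⟪p, ν⟫_ℝ < ⟪q, ν⟫_ℝ)
    (hbasal : ∀ x ∈ X, dist q x = 1 →
      ((x - q) 2 = 0 ∧ ∃ c ∈ ([((0 : ℤ), (1 : ℤ), (0 : ℤ)), (0, 0, 1), (0, 1, -1)] : List (ℤ × ℤ × ℤ)),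
          x = q + barlowPos 1 (Real.sqrt (2 / 3)) constHagg c.1 c.2.1 c.2.2 ∨
          x = q - barlowPos 1 (Real.sqrt (2 / 3)) constHagg c.1 c.2.1 c.2.2) ∨
        (x - q) 2 = Real.sqrt (2 / 3) ∨ (x - q) 2 = -Real.sqrt (2 / 3)) :
    (((X \ P).filter fun x => dist q x = 1 ∧ Φ x < Φ q).card : ℤ)
        + ((P.filter fun p => dist q p = 1).card : ℤ)
      ≤ (12 - ((X.filter fun x => dist q x = 1).card : ℤ))
        + (((X \ P).filter fun x => dist q x = 1 ∧ Φ q < Φ x).card : ℤ) := by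
  classical
  set h : ℝ := Real.sqrt (2 / 3) with hhdef
  have hh0 : 0 ≤ h := Real.sqrt_nonneg _
  have hh2 : h ^ 2 = 2 / 3 := by rw [hhdef, Real.sq_sqrt]; norm_num
  have hh58 : (5 : ℝ) / 8 < h ^ 2 := by rw [hh2]; norm_num
  -- the ν-negative polar partners of `q` (substrate or film), as directions
  set D := (X.filter fun x => dist q x = 1 ∧ ((x - q) 2 = h ∨ (x - q) 2 = -h) ∧ ⟪x - q, ν⟫_ℝ < 0)
    with hD
  set WD := D.image fun x => x - q with hWD
  -- at most three of them: they all lie in ONE polar cone (the sign of `ν₂` decides which)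
  have hDX : ∀ x ∈ D, x ∈ X ∧ dist q x = 1 := fun x hx => ⟨(mem_filter.1 hx).1, (mem_filter.1 hx).2.1⟩
  have hWD3 : WD.card ≤ 3 := by
    obtain ⟨hc, hu, hs⟩ := partners_unitVectors X hX q D hDX
    rw [hWD]
    have e3n : ‖(EuclideanSpace.single (2 : Fin 3) (1 : ℝ))‖ = 1 := by simp
    have hin3 : ∀ v : EuclideanSpace ℝ (Fin 3), ⟪v, EuclideanSpace.single (2 : Fin 3) (1 : ℝ)⟫_ℝ = v 2 :=
      fun v => by simp [EuclideanSpace.inner_single_right]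
    -- the common sign: every element of `D` has `(x − q)₂ · ν₂ < 0`
    have hsign : ∀ x ∈ D, (x - q) 2 * ν 2 < 0 := by
      intro x hx
      obtain ⟨hxX, hd, h2, hneg⟩ := mem_filter.1 hx
      have hnorm : ‖x - q‖ = 1 := by rw [← dist_eq_norm, dist_comm]; exact hd
      have hsq : (x - q) 2 ^ 2 = 2 / 3 := by rcases h2 with h2 | h2 <;> rw [h2] <;> [exact hh2; rw [neg_sq, hh2]]
      have := basal_polar_sign ν (x - q) hν hnorm hν3 hsq
      nlinarith
    have hν0 : ν 2 ≠ 0 := by intro h0; rw [h0] at hν3; norm_num at hν3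
    by_cases hνpos : 0 < ν 2
    · refine card_negCone_le_three_axis (EuclideanSpace.single (2 : Fin 3) (1 : ℝ)) e3n h hh0 hh58 hu
        (fun u hu' => ?_) hs
      obtain ⟨x, hx, rfl⟩ := mem_image.1 hu'
      rw [hin3]
      have hs' := hsign x hx
      rcases (mem_filter.1 hx).2.2.1 with h2 | h2
      · exfalso; rw [h2] at hs'; nlinarith
      · rw [h2]
    · have hνneg : ν 2 < 0 := lt_of_le_of_ne (not_lt.1 hνpos) hν0
      refine card_negCone_le_three_axis (-EuclideanSpace.single (2 : Fin 3) (1 : ℝ))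
        (by rw [norm_neg, e3n]) h hh0 hh58 hu (fun u hu' => ?_) hs
      obtain ⟨x, hx, rfl⟩ := mem_image.1 hu'
      rw [inner_neg_right, hin3]
      have hs' := hsign x hx
      rcases (mem_filter.1 hx).2.2.1 with h2 | h2
      · rw [h2]
      · exfalso; rw [h2] at hs'; nlinarith
  -- the in-plane bond vectors
  set S3 : List (ℤ × ℤ × ℤ) := [((0 : ℤ), (1 : ℤ), (0 : ℤ)), (0, 0, 1), (0, 1, -1)] with hS3
  set W3 : Finset (EuclideanSpace ℝ (Fin 3)) :=
    (S3.map fun c => barlowPos 1 (Real.sqrt (2 / 3)) constHagg c.1 c.2.1 c.2.2).toFinset with hW3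
  have hW3card : W3.card ≤ 3 := by
    rw [hW3]; refine (List.toFinset_card_le _).trans ?_; simp [hS3]
  set W := W3 ∪ WD with hW
  have hWcard : W.card ≤ 6 := (card_union_le _ _).trans (by linarith)
  -- apply the antipodal lemma with `R` = film partners that are not ν-above, `f = ⟪·,ν⟫`
  set R := (X \ P).filter fun x => ⟪x, ν⟫_ℝ ≤ ⟪q, ν⟫_ℝ with hR
  have hRsub : R ⊆ X \ P := filter_subset _ _
  refine antipodal_noGainPotential_of_above X P R hPX hRsub q Φ (fun y => ⟪y, ν⟫_ℝ)
    (fun x hx hd => ?_) (fun x hx hd => hlt x (hRsub hx) hd) (fun x hx hd => heq x (hRsub hx) hd)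
    hplug (fun w => ?_) W hWcard (fun x hx hd hxR => ?_)
  · -- outside `R`: ν-above, hence Φ-above
    have hxQ : x ∈ X \ P := (mem_sdiff.1 hx).1
    have hnot : ¬ ⟪x, ν⟫_ℝ ≤ ⟪q, ν⟫_ℝ := fun hle => (mem_sdiff.1 hx).2 (mem_filter.2 ⟨hxQ, hle⟩)
    have h1 : ¬ Φ x < Φ q := fun hl => hnot ((hlt x hxQ hd).1 hl).le
    have h2 : ¬ Φ x = Φ q := fun he => hnot ((heq x hxQ hd).1 he).le
    omega
  · -- a linear function is midpoint-affine
    rw [inner_add_left, inner_sub_left]; linarith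
  · -- every non-exempt partner is on a line of `W`
    have hνx : ⟪x - q, ν⟫_ℝ < 0 ∨ (⟪x - q, ν⟫_ℝ = 0 ∧ x ∉ P) := by
      by_cases hxP : x ∈ P
      · left; rw [inner_sub_left]; linarith [hplug x hxP hd]
      · have hxR' : x ∈ R := by
          by_contra hxR'; exact hxR (mem_sdiff.2 ⟨mem_sdiff.2 ⟨hx, hxP⟩, hxR'⟩)
        have hle := (mem_filter.1 hxR').2
        rw [inner_sub_left]
        rcases hle.lt_or_eq with hl | he
        · left; linarith
        · right; exact ⟨by linarith, hxP⟩
    rcases hbasal x hx hd with ⟨h0, c, hc, hcx⟩ | hpol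
    · -- in-plane: on a `W3` line
      refine ⟨barlowPos 1 (Real.sqrt (2 / 3)) constHagg c.1 c.2.1 c.2.2, ?_, hcx⟩
      rw [hW, mem_union]; left
      rw [hW3, List.mem_toFinset, List.mem_map]; exact ⟨c, hc, rfl⟩
    · -- polar: ν-level is impossible, so it is ν-negative, i.e. in `D`
      have hnorm : ‖x - q‖ = 1 := by rw [← dist_eq_norm, dist_comm]; exact hd
      have hsq : (x - q) 2 ^ 2 = 2 / 3 := by rcases hpol with h2 | h2 <;> rw [h2] <;> [exact hh2; rw [neg_sq, hh2]]
      have hsgn := basal_polar_sign ν (x - q) hν hnorm hν3 hsq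
      have hneg : ⟪x - q, ν⟫_ℝ < 0 := by
        rcases hνx with hl | ⟨he, _⟩
        · exact hl
        · exfalso; rw [he] at hsgn; simp at hsgn
      refine ⟨x - q, ?_, Or.inl (by abel)⟩
      rw [hW, mem_union]; right
      rw [hWD]; exact mem_image.2 ⟨x, mem_filter.2 ⟨hx, hd, hpol, hneg⟩, rfl⟩

/-! ### The rung -/

/-- **The atom for basal-family Barlow films at normals within `54.7°` of the stacking axis**
(`R = 1`, `C = 0`; registered by name on stmt-Ventures-19144).  For every unit `ν` with
`ν₃² > 1/3`, every `ρ ≥ 1`, and every finite unit packing `X ⊇ P` around the `ν`-slab sample `P`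
whose film balls lie in `Λ₀ ∪ (Λ₀ + w) ∪ (Λ₀ − w)` (all Barlow positions of the basal family) and
above the cut (`−R < ⟪q, ν⟫`): `#cross(P, X \ P) ≤ contactDeficiency (X \ P)`. -/
theorem basalBarlowFilm_adhesion :
    ∃ R C : ℝ, 1 ≤ R ∧ ∀ ν : EuclideanSpace ℝ (Fin 3), ‖ν‖ = 1 → ∀ ρ : ℝ, R ≤ ρ →
      ∀ X P : Finset (EuclideanSpace ℝ (Fin 3)),
      (∀ p ∈ X, ∀ q ∈ X, p ≠ q → 1 ≤ dist p q) → P ⊆ X →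
      (∀ p, p ∈ P ↔ (p ∈ fccStacking 1 (Real.sqrt (2 / 3)) ∧ -(2 * R) ≤ ⟪p, ν⟫_ℝ ∧
        ⟪p, ν⟫_ℝ ≤ -R ∧ ‖p‖ ^ 2 - ⟪p, ν⟫_ℝ ^ 2 ≤ ρ ^ 2)) →
      1 / 3 < ν 2 ^ 2 →
      (∀ q ∈ X \ P, q ∈ fccStacking 1 (Real.sqrt (2 / 3)) ∨
        q - barlowOffset 1 ∈ fccStacking 1 (Real.sqrt (2 / 3)) ∨
        q + barlowOffset 1 ∈ fccStacking 1 (Real.sqrt (2 / 3))) →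
      (∀ q ∈ X \ P, -R < ⟪q, ν⟫_ℝ) →
      ((((P ×ˢ (X \ P)).filter fun pq => dist pq.1 pq.2 = 1).card : ℕ) : ℝ) ≤
        contactDeficiency (X \ P) + C * ρ := by
  classical
  refine ⟨1, 0, le_rfl, fun ν hν ρ hρ X P hX hPX hP hν3 hfilm habove => ?_⟩
  rw [zero_mul, add_zero]
  set f : EuclideanSpace ℝ (Fin 3) → ℝ := fun y => ⟪y, ν⟫_ℝ with hf
  set Φ : EuclideanSpace ℝ (Fin 3) → ℤ := fun x => (((X \ P).filter fun y => f y < f x).card : ℤ) with hΦ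
  have hB : ∀ y ∈ X, y ∈ fccStacking 1 (Real.sqrt (2 / 3)) ∨
      y - barlowOffset 1 ∈ fccStacking 1 (Real.sqrt (2 / 3)) ∨
      y + barlowOffset 1 ∈ fccStacking 1 (Real.sqrt (2 / 3)) := by
    intro y hy
    by_cases hyP : y ∈ P
    · exact Or.inl ((hP y).1 hyP).1
    · exact hfilm y (mem_sdiff.2 ⟨hy, hyP⟩)
  have hmain := cross_le_of_potential X P ∅ hX hPX (empty_subset _) Φ fun q hq => by
    rw [sdiff_empty] at hq
    refine basal_noGainPotential X P hX hPX q Φ ν hν hν3 (fun x hx _ => ?_) (fun x hx _ => ?_)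
      (fun p hp _ => ?_) (fun x hx hd => basal_unit_height (hB q (mem_sdiff.1 hq).1) (hB x hx) hd)
    · simp only [hΦ]; exact rank_lt_iff (X \ P) f x q hx
    · simp only [hΦ]; exact rank_eq_iff (X \ P) f x q hx hq
    · obtain ⟨_, _, hp2, _⟩ := (hP p).1 hp
      have := habove q hq
      show ⟪p, ν⟫_ℝ < ⟪q, ν⟫_ℝ
      linarith
  simpa using hmain

end Summit.Ventures.Crystal3D.Theorems

end
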